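import Mathlib
import Literature.MathematicalPhysics.StatisticalMechanics.OneCrossingMixture

/-!
# `ExactCertificate` (stmt-AtomisticToContinuum-11959), line `closure-makes-nogap-exact`,
# Transfer1D skeleton (`…Cruxes.ExactCertificate.Transfer1D.ExactCertificate1D`): stub `stub_quadAntitone`

Support file for the crux `ThreeConeCertificate.ExactCertificate` (d = 1 transfer).  In the d = 1
exact certificate the positive type of the interpolant comes from a single-crossing lemma applied
to the ANTITONE function `h(t) = Q(t)/t`, where `Q(t) = Σ_i Σ_j w_i w_j e^{−t|x_i − x_j|}` is the
exponential Gram form of a finite weighted point set on `ℝ`.  This file proves that antitonicity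
(registered stub `stub_quadAntitone`):

* `integral_feature_mul_feature` — the one-sided Gram integral
  `∫_ℝ φ_a φ_b = (1 + s(b − a)) e^{−s(b−a)} / (4s³)` for `a ≤ b`, with the features
  `φ_c(u) = (u − c)₊ e^{−s(u − c)}` (translation `u = b + v` and two Euler integrals
  `∫_0^∞ e^{−2sv} v^k dv`, `k = 1, 2`);
* `matern_sum_nonneg` — **the Matérn-3/2 kernel is positive semi-definite on `ℝ`**:
  `0 ≤ Σ_i Σ_j w_i w_j (1 + s|x_i − x_j|) e^{−s|x_i − x_j|}`, since by the Gram identity this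
  double sum is `4s³ ∫ (Σ_i w_i φ_{x_i})² ≥ 0`;
* **`stub_quadAntitone`** — `t ↦ Q(t)/t` is antitone on `(0, ∞)`: its derivative is
  `−t⁻² Σ_i Σ_j w_i w_j (1 + t|x_i − x_j|) e^{−t|x_i − x_j|} ≤ 0` (`antitoneOn_of_deriv_nonpos`).

All `[folklore]` (positive definiteness of the Matérn / Sobolev kernels via one-sided square
integrable features; no Fourier analysis is used).
-/

noncomputable section

namespace Summit.AtomisticToContinuum.Crystallization.Theorems.ThreeConeCertificateExactCertificate.Transfer1D

open Literature.MathematicalPhysics.StatisticalMechanics MeasureTheory Set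
open scoped BigOperators Nat

/-- Translating a function supported on `(0, ∞)` by `b` and integrating over `ℝ` gives its
integral over `(0, ∞)` (Lebesgue measure is translation invariant). -/
theorem integral_indicator_Ioi_comp_sub (g : ℝ → ℝ) (b : ℝ) :
    ∫ u, (Ioi (0 : ℝ)).indicator g (u - b) = ∫ v in Ioi (0 : ℝ), g v := by
  rw [integral_sub_right_eq_self (μ := volume) ((Ioi (0 : ℝ)).indicator g) b,
    integral_indicator measurableSet_Ioi]

/-- **The one-sided Matérn Gram integral.**  For `0 < s` and `a ≤ b`, with the features
`φ_c(u) = (u − c)₊ e^{−s(u − c)}`,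
`∫_ℝ φ_a(u) φ_b(u) du = (1 + s(b − a)) e^{−s(b − a)} / (4 s³)`. -/
theorem integral_feature_mul_feature {s a b : ℝ} (hs : 0 < s) (hab : a ≤ b) :
    ∫ u, (max (u - a) 0 * Real.exp (-(s * (u - a)))) * (max (u - b) 0 * Real.exp (-(s * (u - b))))
      = (1 + s * (b - a)) * Real.exp (-(s * (b - a))) / (4 * s ^ 3) := by
  have h2s : 0 < 2 * s := by positivity
  -- the integrand is the translate by `b` of a function supported on `(0, ∞)`
  have h1 : (fun u => (max (u - a) 0 * Real.exp (-(s * (u - a)))) *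
        (max (u - b) 0 * Real.exp (-(s * (u - b)))))
      = fun u => (Ioi (0 : ℝ)).indicator (fun v =>
          Real.exp (-(s * (b - a))) * (Real.exp (-(v * (2 * s))) * v ^ 2)
          + Real.exp (-(s * (b - a))) * (b - a) * (Real.exp (-(v * (2 * s))) * v ^ 1)) (u - b) := by
    funext u
    by_cases hu : 0 < u - b
    · have hmem : u - b ∈ Ioi (0 : ℝ) := hu
      rw [indicator_of_mem hmem, max_eq_left hu.le, max_eq_left (by linarith : (0 : ℝ) ≤ u - a),
        show -(s * (u - a)) = -(s * (b - a)) + -(s * (u - b)) by ring, Real.exp_add,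
        show -((u - b) * (2 * s)) = -(s * (u - b)) + -(s * (u - b)) by ring, Real.exp_add]
      ring
    · have hmem : u - b ∉ Ioi (0 : ℝ) := hu
      rw [indicator_of_notMem hmem, max_eq_right (not_lt.mp hu)]
      ring
  have hi2 : Integrable (fun v : ℝ => Real.exp (-(v * (2 * s))) * v ^ 2) (volume.restrict (Ioi 0)) :=
    integrableOn_exp_neg_mul_mul_pow 2 h2s
  have hi1 : Integrable (fun v : ℝ => Real.exp (-(v * (2 * s))) * v ^ 1) (volume.restrict (Ioi 0)) :=
    integrableOn_exp_neg_mul_mul_pow 1 h2s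
  rw [h1, integral_indicator_Ioi_comp_sub, integral_add (hi2.const_mul _) (hi1.const_mul _),
    integral_const_mul, integral_const_mul, integral_exp_neg_mul_mul_pow 2 h2s,
    integral_exp_neg_mul_mul_pow 1 h2s]
  simp only [Nat.factorial, Nat.succ_eq_add_one, Nat.cast_mul, Nat.cast_one]
  have hs0 : s ≠ 0 := hs.ne'
  field_simp
  ring

/-- **The Matérn-3/2 kernel is positive semi-definite on `ℝ`.**  For `0 < s`, every `n`, points
`x : Fin n → ℝ` and weights `w : Fin n → ℝ`,
`0 ≤ Σ_i Σ_j w_i w_j (1 + s|x_i − x_j|) e^{−s|x_i − x_j|}`: by `integral_feature_mul_feature` the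
double sum equals `4s³ ∫ (Σ_i w_i φ_{x_i}(u))² du`. -/
theorem matern_sum_nonneg {s : ℝ} (hs : 0 < s) (n : ℕ) (x w : Fin n → ℝ) :
    0 ≤ ∑ i, ∑ j, w i * w j * ((1 + s * |x i - x j|) * Real.exp (-(s * |x i - x j|))) := by
  -- the Gram identity for each pair
  have key : ∀ i j : Fin n,
      ∫ u, (max (u - x i) 0 * Real.exp (-(s * (u - x i)))) *
          (max (u - x j) 0 * Real.exp (-(s * (u - x j))))
        = (1 + s * |x i - x j|) * Real.exp (-(s * |x i - x j|)) / (4 * s ^ 3) := by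
    intro i j
    rcases le_total (x i) (x j) with h | h
    · rw [integral_feature_mul_feature hs h, abs_sub_comm, abs_of_nonneg (sub_nonneg.mpr h)]
    · rw [abs_of_nonneg (sub_nonneg.mpr h), ← integral_feature_mul_feature hs h]
      congr 1
      funext u
      ring
  -- every product of weighted features is integrable (its integral is nonzero)
  have hint : ∀ i j : Fin n, Integrable (fun u : ℝ =>
      (w i * (max (u - x i) 0 * Real.exp (-(s * (u - x i))))) *
        (w j * (max (u - x j) 0 * Real.exp (-(s * (u - x j)))))) := by
    intro i j
    have h0 : Integrable (fun u : ℝ => (max (u - x i) 0 * Real.exp (-(s * (u - x i)))) *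
        (max (u - x j) 0 * Real.exp (-(s * (u - x j))))) := by
      refine Integrable.of_integral_ne_zero ?_
      rw [key]
      positivity
    refine (h0.const_mul (w i * w j)).congr (ae_of_all _ fun u => ?_)
    dsimp only
    ring
  have expand : ∑ i, ∑ j, w i * w j * ((1 + s * |x i - x j|) * Real.exp (-(s * |x i - x j|)))
      = 4 * s ^ 3 * ∫ u, (∑ i, w i * (max (u - x i) 0 * Real.exp (-(s * (u - x i))))) ^ 2 := by
    calc ∑ i, ∑ j, w i * w j * ((1 + s * |x i - x j|) * Real.exp (-(s * |x i - x j|)))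
        = ∑ i, ∑ j, 4 * s ^ 3 * ∫ u, (w i * (max (u - x i) 0 * Real.exp (-(s * (u - x i))))) *
            (w j * (max (u - x j) 0 * Real.exp (-(s * (u - x j))))) := by
          refine Finset.sum_congr rfl fun i _ => Finset.sum_congr rfl fun j _ => ?_
          have hI : ∫ u, (w i * (max (u - x i) 0 * Real.exp (-(s * (u - x i))))) *
              (w j * (max (u - x j) 0 * Real.exp (-(s * (u - x j)))))
              = w i * w j * ((1 + s * |x i - x j|) * Real.exp (-(s * |x i - x j|)) / (4 * s ^ 3)) := by
            rw [← key, ← integral_const_mul]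
            congr 1
            funext u
            ring
          rw [hI]
          have hs0 : s ≠ 0 := hs.ne'
          field_simp
      _ = 4 * s ^ 3 * ∑ i, ∑ j, ∫ u, (w i * (max (u - x i) 0 * Real.exp (-(s * (u - x i))))) *
            (w j * (max (u - x j) 0 * Real.exp (-(s * (u - x j))))) := by
          rw [Finset.mul_sum]
          refine Finset.sum_congr rfl fun i _ => ?_
          rw [Finset.mul_sum]
      _ = 4 * s ^ 3 * ∫ u, ∑ i, ∑ j, (w i * (max (u - x i) 0 * Real.exp (-(s * (u - x i))))) *
            (w j * (max (u - x j) 0 * Real.exp (-(s * (u - x j))))) := by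
          congr 1
          rw [integral_finsetSum _ (fun i _ => integrable_finsetSum _ (fun j _ => hint i j))]
          refine Finset.sum_congr rfl fun i _ => ?_
          rw [integral_finsetSum _ (fun j _ => hint i j)]
      _ = 4 * s ^ 3 * ∫ u, (∑ i, w i * (max (u - x i) 0 * Real.exp (-(s * (u - x i))))) ^ 2 := by
          congr 1
          refine integral_congr_ae (ae_of_all _ fun u => ?_)
          dsimp only
          rw [sq, Finset.sum_mul_sum]
  rw [expand]
  exact mul_nonneg (by positivity) (integral_nonneg fun u => sq_nonneg _)

/-- **`stub_quadAntitone`** (registered stub of the Transfer1D skeleton).  For every finite weighted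
point set on `ℝ`, `t ↦ Q(t)/t` with `Q(t) = Σ_i Σ_j w_i w_j e^{−t|x_i − x_j|}` is antitone on
`(0, ∞)`: `(Q(t)/t)' = −t⁻² Σ_i Σ_j w_i w_j (1 + t|x_i − x_j|) e^{−t|x_i − x_j|} ≤ 0` by
`matern_sum_nonneg` (Matérn-3/2 is positive semi-definite). -/
theorem stub_quadAntitone : ∀ (n : ℕ) (x : Fin n → ℝ) (w : Fin n → ℝ),
    AntitoneOn (fun t : ℝ => (∑ i, ∑ j, w i * w j * Real.exp (-(t * |x i - x j|))) / t) (Set.Ioi 0) := by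
  intro n x w
  -- the derivative of `Q(t)/t` at every `t > 0`
  have hderiv : ∀ t : ℝ, 0 < t →
      HasDerivAt (fun t : ℝ => (∑ i, ∑ j, w i * w j * Real.exp (-(t * |x i - x j|))) / t)
        (((∑ i, ∑ j, w i * w j * (-|x i - x j| * Real.exp (-(t * |x i - x j|)))) * t
          - (∑ i, ∑ j, w i * w j * Real.exp (-(t * |x i - x j|))) * 1) / t ^ 2) t := by
    intro t ht
    refine HasDerivAt.fun_div ?_ (hasDerivAt_id' t) ht.ne'
    refine HasDerivAt.fun_sum fun i _ => HasDerivAt.fun_sum fun j _ => ?_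
    refine ((((hasDerivAt_id' t).mul_const |x i - x j|).fun_neg.exp).const_mul
      (w i * w j)).congr_deriv ?_
    ring
  refine antitoneOn_of_deriv_nonpos (convex_Ioi 0) (fun t ht => (hderiv t ht).continuousAt.continuousWithinAt) ?_ ?_
  · rw [interior_Ioi]
    exact fun t ht => (hderiv t ht).differentiableAt.differentiableWithinAt
  · rw [interior_Ioi]
    intro t ht
    have ht' : (0 : ℝ) < t := ht
    rw [(hderiv t ht').deriv]
    refine div_nonpos_of_nonpos_of_nonneg ?_ (sq_nonneg t)
    have hM := matern_sum_nonneg ht' n x w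
    have hsum : (∑ i, ∑ j, w i * w j * (-|x i - x j| * Real.exp (-(t * |x i - x j|)))) * t
        - (∑ i, ∑ j, w i * w j * Real.exp (-(t * |x i - x j|))) * 1
        = -∑ i, ∑ j, w i * w j * ((1 + t * |x i - x j|) * Real.exp (-(t * |x i - x j|))) := by
      rw [Finset.sum_mul, mul_one, ← Finset.sum_sub_distrib, ← Finset.sum_neg_distrib]
      refine Finset.sum_congr rfl fun i _ => ?_
      rw [Finset.sum_mul, ← Finset.sum_sub_distrib, ← Finset.sum_neg_distrib]
      refine Finset.sum_congr rfl fun j _ => ?_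
      ring
    rw [hsum]
    linarith

end Summit.AtomisticToContinuum.Crystallization.Theorems.ThreeConeCertificateExactCertificate.Transfer1D

end
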